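import Mathlib
import HarnessLib
import Literature.NumberTheory.Automorphic.StrongArtinGL2
import Literature.NumberTheory.GaloisRepresentations.GaloisRep

/-!
# Oddness along the contragredient transport (crux stmt-Langlands-15111, line Sketch) —
helper file (`--supports`), odd base-change sector of R′

For a `p`-adic representation `ρ : Γ_ℚ → GL₂(ℚ̄_p)` and its complex contragredient transport
`τ g = ι(((ρ g)⁻¹)ᵀ)` along a field isomorphism `ι : ℚ̄_p ≃+* ℂ`, the determinant of `τ` at a
complex conjugation `c` is `det τ(c) = ι(det ((ρ c)⁻¹)ᵀ) = ι((det ρ(c))⁻¹)`; so if `ρ` is odd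
(`det ρ(c) = -1`) then `det τ(c) = ι((-1)⁻¹) = -1`, i.e. `τ` is odd.  Pure determinant algebra:
no continuity of `ι` is used.

* `stub_isOddDualTransport` — `ρ.IsOdd → τ.IsOdd` for the contragredient transport.

No definitions.
-/

noncomputable section

open scoped BigOperators Topology Classical Matrix NumberField MatrixGroups
open Literature.NumberTheory.Automorphic Literature.NumberTheory.GaloisRepresentations
  IsDedekindDomain NumberField Filter

-- `Summit.Langlands.Langlands.…`: summit = sub-problem name (D-0017 nested layout), not a typo.
set_option linter.dupNamespace false

namespace Summit.Langlands.Langlands.Theorems.ArtinWeightRealisationLevel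

/-- **Oddness along the contragredient transport.**  For `τ g = ι(((ρ g)⁻¹)ᵀ)`:
`det τ(c) = ι((det ρ(c))⁻¹)`, so `τ` is odd when `ρ` is. [folklore] -/
theorem stub_isOddDualTransport : ∀ {p : ℕ} [Fact p.Prime] (ι : PadicAlgCl p ≃+* ℂ) (ρ : Literature.NumberTheory.GaloisRepresentations.FramedGaloisRep ℚ (PadicAlgCl p) 2) (τ : Literature.NumberTheory.GaloisRepresentations.FramedArtinRep ℚ 2), (∀ g : Field.absoluteGaloisGroup ℚ, ((τ g : GL (Fin 2) ℂ) : Matrix (Fin 2) (Fin 2) ℂ) = ((((ρ g)⁻¹ : GL (Fin 2) (PadicAlgCl p)) : Matrix (Fin 2) (Fin 2) (PadicAlgCl p))ᵀ).map (ι : PadicAlgCl p → ℂ)) → ρ.IsOdd → Literature.NumberTheory.GaloisRepresentations.FramedGaloisRep.IsOdd τ := by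
  intro p _ ι ρ τ hτ hodd φ c hc
  -- `det ρ(c) = -1`, hence `det (ρ c)⁻¹ = (-1)⁻¹ = -1` (in units).
  have hinv : Matrix.GeneralLinearGroup.det (ρ c)⁻¹ = -1 := by
    rw [map_inv, hodd φ c hc, inv_neg_one]
  -- `det (M.map ι) = ι (det M)`.
  have key : ∀ M : Matrix (Fin 2) (Fin 2) (PadicAlgCl p),
      (M.map (ι : PadicAlgCl p → ℂ)).det = ι M.det := fun M => by
    rw [RingEquiv.map_det, RingEquiv.mapMatrix_apply]
  apply Units.ext
  rw [Matrix.GeneralLinearGroup.val_det_apply, hτ c, key, Matrix.det_transpose,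
    ← Matrix.GeneralLinearGroup.val_det_apply, hinv, Units.val_neg, Units.val_one, map_neg, map_one,
    Units.val_neg, Units.val_one]

end Summit.Langlands.Langlands.Theorems.ArtinWeightRealisationLevel

end
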